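import Summits.QuantumFields.YangMills.Theorems.BalabanUVNodesN15KingModelTwoPointThermodynamicLimit
import Summits.QuantumFields.YangMills.Theorems.BalabanUVNodesN15KingModelTheorem21SumRules

/-!
# BalabanUVNodes ∕ N15 — THE KING-MODEL RUNG (PART Ϝ-k): THE INFINITE-VOLUME TWO-POINT FUNCTION DECAYS EXPONENTIALLY AND ITS SUSCEPTIBILITY IS EXACTLY `m⁻²` —
# `|S₂^{ℝ}(z)| ≤ (2∕γ_m)e^{−κ_M|z_ν|}` (`z ≠ 0`, every coordinate), `Σ_{z∈ℤ^{d+1}} S₂^{ℝ}(z) = m⁻²`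
# (Track A, DAG node N15 = NE2; FAN-OUT v1.1 §N15 s3 «KING-MODEL RUNG … NE2's analogue DECIDED in the model»)

HONEST FRAMING.  Count-neutral (cell `pub-ymgap`, seat `pub-ymgap-dag-n15-e` g33; `--supports stmt-QuantumFields-27366 --as helper` = K3⁸
`SpineGivenEndpointR13SepCoPHV`).  TEMPLATE LITERATURE: C. King, *The U(1) Higgs model. I. The continuum limit*, Commun. Math. Phys. **102** (1986) 649–677
[King1986] — KING's OWN `A = 0`, `g = 0` MODEL: the block-smeared two-point function of the FREE massive field on `ℝ^{d+1}`, `S₂^{ℝ}(z)` (part Ϝ-j's thermodynamic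
limit `kingS2Inf`).  The decay rate is the tree's Combes–Thomas rate `κ_M` of Thm 3.3 (part Ϡ-j), NOT the optimal rate `m`; "mass gap" below means this exponential
clustering of the FREE model and nothing about Yang–Mills.  NOT Bałaban's objects; NOT a node discharge (N15 is booked through n15-a's knit, untouched here); nothing
continuum-Yang–Mills ∕ ℝ⁴ ∕ OS ∕ Clay.  0 `sorry`; standard axioms; ONE plumbing definition (`torRep`, the centred representatives).

THE MATHEMATICS.  On the unit torus `Ω = Π ℤ∕M_ν`, part Ϡ-j∕Ϝ-d give `|S₂^{(∞)}_Ω(0,b)| ≤ (2∕γ_m)e^{−κ_M d_T(0,b)}` (`b ≠ 0`) and part Ϝ-h gives `Σ_{b∈Ω} S₂^{(∞)}_Ω(0,b) = m⁻²`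
EXACTLY.  Read through the CENTRED representatives `v(b) ∈ Π(−M_ν∕2, M_ν∕2]` the torus distance dominates every coordinate, `d_T(0,b) ≥ |v(b)_ν|` (`circAbs` of a
centred integer is its absolute value), so `e^{−κd_T(0,b)} ≤ Π_ν e^{−(κ∕(d+1))|v_ν|}` — a SUMMABLE majorant on `ℤ^{d+1}`, uniform in `Ω`.  For a fixed `z ∈ ℤ^{d+1}` and
all `M_ν > 2|z_ν|`, `z` IS the centred representative of `z mod M`; hence, along tori with all periods `→ ∞`, (i) the decay bound passes to part Ϝ-j's limit:
`|S₂^{ℝ}(z)| ≤ (2∕γ_m)e^{−κ_M|z_ν|}` for every `ν` (`z ≠ 0`), and (ii) the torus sum rule, written as a sum over `ℤ^{d+1}` of the kernel transported to centred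
representatives (zero elsewhere), converges termwise to `Σ_z S₂^{ℝ}(z)` under the uniform majorant (TANNERY): `Σ_{z∈ℤ^{d+1}} S₂^{ℝ}(z) = m⁻²` — the static
susceptibility of the free field in infinite volume, unrenormalised.

WHAT THIS FILE PROVES (kernel).  §1 `torRep`, `intCast_torRep`, `torRep_injective`, `two_abs_torRep_le`, ★ `abs_torRep_le_tdistT` (`|v(b)_ν| ≤ d_T(0,b)`), `valMinAbs_intCast_of_two_abs_lt`,
`torRep_intCast_of_two_abs_lt`.  §2 `summable_exp_neg_mul_abs_int`, `sum_box_prod_exp_le`, ★ `summable_prod_exp_neg_abs` (the majorant on `ℤ^n`), `exp_neg_tdistT_le_prod`.  §3 ★★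
**`abs_kingS2Inf_le_decay`** (INFINITE-VOLUME EXPONENTIAL DECAY, every coordinate).  §4 `repKernel` letters, `tsum_repKernel_eq` (the torus sum rule as a `ℤ^{d+1}`-series), `abs_repKernel_le`,
`tendsto_repKernel`, ★ `summable_kingS2Inf`, ★★★ **`tsum_kingS2Inf_eq_inv_mass`** (`Σ_{z∈ℤ^{d+1}} S₂^{ℝ}(z) = m⁻²`).

HONEST SCOPE.  Free field; unit-block smearing; auxiliary constants `(a, L)` of parts Ϡ-e∕Ϡ-j enter only `γ_m, κ_M` (every `a > 0`, odd `L ≥ 3` admissible).  N15 untouched;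
counts unmoved.  Locators: [King1986] Thm 2.1 (2.22)–(2.23) p.654, Thm 3.3 (3.6) p.655, (2.14) p.653, (4.5) p.670.
-/

noncomputable section

open scoped BigOperators
open Finset Filter Topology

namespace Summit.QuantumFields.YangMills.BalabanUVNodes.N15KingModelRung

open Literature.MathematicalPhysics.QuantumFieldTheory.Balaban1983to89.B5Prop11Plancherel (Tor fine chi sOf)
open Literature.MathematicalPhysics.QuantumFieldTheory.Balaban1983to89.B4TorusKernel.MultiPeriod (circAbs circAbs_of_centred circAbs_add_mul circAbs_nonneg)
open Literature.MathematicalPhysics.QuantumFieldTheory.King1986 (aliasBox)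
open Literature.MathematicalPhysics.QuantumFieldTheory.King1986.Torus

variable {n : ℕ}

/-! ## §1 Centred representatives and the torus distance from the origin -/

section Rep

variable (M : Fin n → ℕ) [hM : ∀ ν, NeZero (M ν)]

/-- The centred representative `v(b) ∈ Π_ν (−M_ν∕2, M_ν∕2]` of a unit site. [folklore] -/
def torRep (b : Tor M) : Fin n → ℤ := fun ν => ((b ν).valMinAbs : ℤ)

omit hM in
/-- `v(b) mod M = b`. [folklore] -/
theorem intCast_torRep (b : Tor M) : (fun ν => ((torRep M b ν : ℤ) : ZMod (M ν))) = b := by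
  funext ν; simp [torRep, ZMod.coe_valMinAbs]

omit hM in
/-- `v` is injective. [folklore] -/
theorem torRep_injective : Function.Injective (torRep M) := fun b b' h => by
  rw [← intCast_torRep M b, ← intCast_torRep M b', h]

/-- `2|v(b)_ν| ≤ M_ν`. [folklore] -/
theorem two_abs_torRep_le (b : Tor M) (ν : Fin n) : 2 * |torRep M b ν| ≤ (M ν : ℤ) := by
  have h := ZMod.natAbs_valMinAbs_le (b ν)
  have h2 : ((b ν).valMinAbs.natAbs : ℤ) ≤ ((M ν / 2 : ℕ) : ℤ) := by exact_mod_cast h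
  rw [Int.natCast_natAbs] at h2
  simp only [torRep]
  omega

/-- ★ **THE TORUS DISTANCE DOMINATES EVERY CENTRED COORDINATE**: `|v(b)_ν| ≤ d_T(0, b)`. [folklore] -/
theorem abs_torRep_le_tdistT (b : Tor M) (ν : Fin n) : (|torRep M b ν| : ℝ) ≤ tdistT M 0 b := by
  have hMν : 1 ≤ M ν := Nat.one_le_iff_ne_zero.mpr (NeZero.ne (M ν))
  have h := circAbs_le_tdistT M 0 b ν
  -- `val(b_ν) = v(b)_ν + M_ν·t`
  have hdvd : (M ν : ℤ) ∣ ((b ν).val : ℤ) - torRep M b ν := by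
    rw [← ZMod.intCast_eq_intCast_iff_dvd_sub]
    simp [torRep, ZMod.coe_valMinAbs]
  obtain ⟨t, ht⟩ := hdvd
  have hval : ((b ν).val : ℤ) = torRep M b ν + (M ν : ℤ) * t := by linarith
  have h0 : (((0 : Tor M) ν).val : ℤ) = 0 := by simp
  rw [h0, zero_sub, Literature.MathematicalPhysics.QuantumFieldTheory.Balaban1983to89.B4Sect5Torus.circAbs_neg hMν, hval, circAbs_add_mul,
    circAbs_of_centred hMν (two_abs_torRep_le M b ν)] at h
  exact_mod_cast h

omit hM in
/-- A centred integer is its own centred residue: `2|z| < M ⇒ v(z mod M) = z`. [folklore] -/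
theorem valMinAbs_intCast_of_two_abs_lt {Mn : ℕ} [NeZero Mn] {z : ℤ} (hz : 2 * |z| < Mn) : (((z : ℤ) : ZMod Mn)).valMinAbs = z := by
  rcases le_or_gt 0 z with h0 | h0
  · lift z to ℕ using h0
    have hz' : z ≤ Mn / 2 := by
      have : (2 * z : ℤ) < Mn := by simpa using hz
      omega
    rw [Int.cast_natCast, ZMod.valMinAbs_natCast_of_le_half hz']
  · have hneg : 0 ≤ -z := by linarith
    obtain ⟨w, hw⟩ : ∃ w : ℕ, (w : ℤ) = -z := ⟨(-z).toNat, Int.toNat_of_nonneg hneg⟩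
    have hzw : z = -(w : ℤ) := by linarith
    have hw2 : 2 * w < Mn := by
      have : (2 * w : ℤ) < Mn := by rw [hw, show (2 : ℤ) * -z = 2 * |z| by rw [abs_of_neg h0]]; exact hz
      omega
    have hwle : w ≤ Mn / 2 := by omega
    have hne : 2 * ((w : ℕ) : ZMod Mn).val ≠ Mn := by
      rw [ZMod.val_natCast, Nat.mod_eq_of_lt (by omega)]; omega
    rw [hzw, Int.cast_neg, Int.cast_natCast, ZMod.valMinAbs_neg_of_ne_half hne, ZMod.valMinAbs_natCast_of_le_half hwle]

/-- For `2|z_ν| < M_ν` (all `ν`), `z` is the centred representative of `z mod M`. [folklore] -/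
theorem torRep_intCast_of_two_abs_lt {z : Fin n → ℤ} (hz : ∀ ν, 2 * |z ν| < M ν) :
    torRep M (fun ν => ((z ν : ℤ) : ZMod (M ν))) = z := by
  funext ν; exact valMinAbs_intCast_of_two_abs_lt (hz ν)

end Rep

/-! ## §2 The uniform majorant `Π_ν e^{−c|z_ν|}` on `ℤ^n` -/

section Majorant

/-- `k ↦ e^{−c|k|}` is summable on `ℤ` (`c > 0`). [folklore] -/
theorem summable_exp_neg_mul_abs_int {c : ℝ} (hc : 0 < c) : Summable fun k : ℤ => Real.exp (-(c * |(k : ℝ)|)) := by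
  have hr : Real.exp (-c) < 1 := Real.exp_lt_one_iff.mpr (by linarith)
  have hr0 : 0 ≤ Real.exp (-c) := (Real.exp_pos _).le
  have hgeo : Summable fun k : ℕ => Real.exp (-c) ^ k := summable_geometric_of_lt_one hr0 hr
  have hnat : ∀ k : ℕ, Real.exp (-(c * |((k : ℤ) : ℝ)|)) = Real.exp (-c) ^ k := fun k => by
    rw [Int.cast_natCast, Nat.abs_cast, ← Real.exp_nat_mul]; ring_nf
  have hneg : ∀ k : ℕ, Real.exp (-(c * |((-(k : ℤ) : ℤ) : ℝ)|)) = Real.exp (-c) ^ k := fun k => by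
    rw [Int.cast_neg, Int.cast_natCast, abs_neg, Nat.abs_cast, ← Real.exp_nat_mul]; ring_nf
  refine Summable.of_nat_of_neg ?_ ?_
  · simpa only [hnat] using hgeo
  · simpa only [hneg] using hgeo

/-- Box sums of the product majorant are bounded by the product of the one-dimensional series. [folklore] -/
theorem sum_box_prod_exp_le {c : ℝ} (hc : 0 < c) (N : ℕ) :
    ∑ z ∈ aliasBox n N, ∏ ν, Real.exp (-(c * |(z ν : ℝ)|)) ≤ (∑' k : ℤ, Real.exp (-(c * |(k : ℝ)|))) ^ n := by
  unfold aliasBox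
  have hswap : ∑ z ∈ Fintype.piFinset (fun _ : Fin n => Finset.Icc (-(N : ℤ)) N), ∏ ν, Real.exp (-(c * |(z ν : ℝ)|))
      = ∏ ν : Fin n, ∑ k ∈ Finset.Icc (-(N : ℤ)) N, Real.exp (-(c * |(k : ℝ)|)) :=
    (Finset.prod_univ_sum (fun _ : Fin n => Finset.Icc (-(N : ℤ)) N) (fun (_ : Fin n) (k : ℤ) => Real.exp (-(c * |(k : ℝ)|)))).symm
  rw [hswap]
  calc ∏ ν : Fin n, ∑ k ∈ Finset.Icc (-(N : ℤ)) N, Real.exp (-(c * |(k : ℝ)|)) ≤ ∏ _ν : Fin n, ∑' k : ℤ, Real.exp (-(c * |(k : ℝ)|)) :=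
        Finset.prod_le_prod (fun ν _ => Finset.sum_nonneg fun k _ => (Real.exp_pos _).le)
          (fun ν _ => (summable_exp_neg_mul_abs_int hc).sum_le_tsum _ (fun k _ => (Real.exp_pos _).le))
    _ = (∑' k : ℤ, Real.exp (-(c * |(k : ℝ)|))) ^ n := by rw [Finset.prod_const, Finset.card_univ, Fintype.card_fin]

/-- ★ `z ↦ Π_ν e^{−c|z_ν|}` is summable on `ℤ^n` (`c > 0`). [folklore] -/
theorem summable_prod_exp_neg_abs {c : ℝ} (hc : 0 < c) : Summable fun z : Fin n → ℤ => ∏ ν, Real.exp (-(c * |(z ν : ℝ)|)) := by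
  refine summable_of_sum_le (c := (∑' k : ℤ, Real.exp (-(c * |(k : ℝ)|))) ^ n) (fun z => Finset.prod_nonneg fun ν _ => (Real.exp_pos _).le) fun u => ?_
  obtain ⟨N, hN⟩ := exists_subset_aliasBox u
  exact (Finset.sum_le_sum_of_subset_of_nonneg hN fun z _ _ => Finset.prod_nonneg fun ν _ => (Real.exp_pos _).le).trans (sum_box_prod_exp_le hc N)

/-- If `T ≥ |z_ν|` for all `ν` then `e^{−κT} ≤ Π_ν e^{−(κ∕(d+1))|z_ν|}` (`κ ≥ 0`, dimension `d + 1 ≥ 1`). [folklore] -/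
theorem exp_neg_le_prod_of_forall_le {d : ℕ} {κ T : ℝ} (hκ : 0 ≤ κ) {z : Fin (d + 1) → ℤ} (hT : ∀ ν, (|z ν| : ℝ) ≤ T) :
    Real.exp (-(κ * T)) ≤ ∏ ν, Real.exp (-(κ / (d + 1 : ℕ) * |(z ν : ℝ)|)) := by
  rw [← Real.exp_sum]
  refine Real.exp_le_exp.mpr ?_
  have hκn : 0 ≤ κ / (d + 1 : ℕ) := by positivity
  have hsum : ∑ _ν : Fin (d + 1), -(κ / (d + 1 : ℕ) * T) ≤ ∑ ν : Fin (d + 1), -(κ / (d + 1 : ℕ) * |(z ν : ℝ)|) :=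
    Finset.sum_le_sum fun ν _ => by have := hT ν; nlinarith
  rw [Finset.sum_const, Finset.card_univ, Fintype.card_fin, nsmul_eq_mul] at hsum
  have hn' : ((d + 1 : ℕ) : ℝ) ≠ 0 := by positivity
  calc -(κ * T) = ((d + 1 : ℕ) : ℝ) * -(κ / (d + 1 : ℕ) * T) := by field_simp
    _ ≤ ∑ ν : Fin (d + 1), -(κ / (d + 1 : ℕ) * |(z ν : ℝ)|) := hsum

end Majorant

/-! ## §3 Exponential decay of the infinite-volume two-point function -/

section Decay

variable {d : ℕ}

/-- ★★ **EXPONENTIAL DECAY IN INFINITE VOLUME**: for `m² > 0`, every auxiliary `a > 0` and odd `L ≥ 2`, every `z ≠ 0` in `ℤ^{d+1}` and EVERY coordinate `ν`: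
`|S₂^{ℝ}(z)| ≤ (2∕γ_m)·e^{−κ_M|z_ν|}` — the free field's block-smeared two-point function clusters exponentially (Combes–Thomas rate of Thm 3.3).
[cite: King1986, Thm 3.3 (3.6) p.655, Thm 2.1 (2.22) p.654] -/
theorem abs_kingS2Inf_le_decay (L : ℕ) (hLodd : Odd L) (hL : 2 ≤ L) {a m2 : ℝ} (ha : 0 < a) (hm : 0 < m2) {z : Fin (d + 1) → ℤ} (hz : z ≠ 0)
    (ν : Fin (d + 1)) :
    |kingS2Inf m2 z| ≤ 2 / gamM a m2 L * Real.exp (-(kapM (d + 1) a m2 L * |(z ν : ℝ)|)) := by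
  -- along the cubic tori `(ℤ∕(k+1))^{d+1}`
  set Mseq : ℕ → Fin (d + 1) → ℕ := fun k _ => k + 1 with hMseq
  have hpos : ∀ k ν, 0 < Mseq k ν := fun k _ => Nat.succ_pos k
  have hlimM : ∀ ν, Tendsto (fun k => (Mseq k ν : ℝ)) atTop atTop := fun ν => by
    have : Tendsto (fun k : ℕ => ((k : ℝ) + 1)) atTop atTop := tendsto_atTop_add_const_right _ 1 tendsto_natCast_atTop_atTop
    refine this.congr fun k => ?_
    simp [hMseq]
  have hlim := tendsto_kingS2Lim_volume hm Mseq hpos hlimM z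
  have hκ : 0 < kapM (d + 1) a m2 L := (kapM_pos_le (d := d + 1) ha hm hL).1
  refine le_of_tendsto ((continuous_abs.tendsto _).comp hlim) ?_
  -- eventually all periods exceed `2|z_μ|`
  have hev : ∀ μ, ∀ᶠ k in atTop, (2 * |z μ| : ℝ) < Mseq k μ := fun μ => (hlimM μ).eventually_gt_atTop _
  filter_upwards [Filter.eventually_all.mpr hev] with k hk
  haveI : ∀ μ, NeZero (Mseq k μ) := fun μ => ⟨(hpos k μ).ne'⟩
  have hk' : ∀ μ, 2 * |z μ| < (Mseq k μ : ℤ) := fun μ => by exact_mod_cast hk μ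
  set b : Tor (Mseq k) := fun μ => ((z μ : ℤ) : ZMod (Mseq k μ)) with hb
  have hrep : torRep (Mseq k) b = z := torRep_intCast_of_two_abs_lt (Mseq k) (fun μ => by exact_mod_cast hk' μ)
  have hb0 : (0 : Tor (Mseq k)) ≠ b := by
    intro h0
    apply hz
    rw [← hrep, ← h0]
    funext μ; simp [torRep]
  have hdec := abs_kingS2Lim_le_decay L (Mseq k) hLodd hL ha hm hb0
  have hdist : (|z ν| : ℝ) ≤ tdistT (Mseq k) 0 b := by
    have := abs_torRep_le_tdistT (Mseq k) b ν
    rwa [hrep] at this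
  simp only [Function.comp_apply]
  refine hdec.trans (mul_le_mul_of_nonneg_left (Real.exp_le_exp.mpr ?_) (by have := gamM_pos ha hm hL; positivity))
  have := mul_le_mul_of_nonneg_left hdist hκ.le
  linarith

end Decay

/-! ## §4 The susceptibility sum rule in infinite volume -/

section SumRule

variable {d : ℕ}

/-- The torus kernel transported to centred representatives of `ℤ^{d+1}` (zero off the fundamental domain). [folklore] -/
def repKernel (M : Fin (d + 1) → ℕ) [∀ ν, NeZero (M ν)] (m2 : ℝ) (z : Fin (d + 1) → ℤ) : ℝ :=
  if torRep M (fun ν => ((z ν : ℤ) : ZMod (M ν))) = z then kingS2Lim M m2 0 (fun ν => ((z ν : ℤ) : ZMod (M ν))) else 0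

/-- On representatives the transported kernel is the torus kernel. [folklore] -/
theorem repKernel_torRep (M : Fin (d + 1) → ℕ) [∀ ν, NeZero (M ν)] (m2 : ℝ) (b : Tor M) :
    repKernel M m2 (torRep M b) = kingS2Lim M m2 0 b := by
  have h := intCast_torRep M b
  unfold repKernel
  rw [h, if_pos rfl]

/-- ★ THE TORUS SUM RULE AS A `ℤ^{d+1}`-SERIES: `Σ_{z∈ℤ^{d+1}} repKernel_Ω(z) = Σ_{b∈Ω} S₂^{(∞)}_Ω(0,b) = m⁻²`. [cite: King1986, (4.5) p.670, (2.14) p.653] -/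
theorem tsum_repKernel_eq (M : Fin (d + 1) → ℕ) [∀ ν, NeZero (M ν)] (m2 : ℝ) : ∑' z : Fin (d + 1) → ℤ, repKernel M m2 z = m2⁻¹ := by
  have hsupp : Function.support (repKernel M m2) ⊆ Set.range (torRep M) := by
    intro z hz
    rw [Function.mem_support] at hz
    unfold repKernel at hz
    by_cases h : torRep M (fun ν => ((z ν : ℤ) : ZMod (M ν))) = z
    · exact ⟨_, h⟩
    · rw [if_neg h] at hz; exact absurd rfl hz
  rw [← (torRep_injective M).tsum_eq hsupp, tsum_fintype]
  simp_rw [repKernel_torRep]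
  exact sum_kingS2Lim_eq M m2 0

/-- The uniform majorant: `|repKernel_Ω(z)| ≤ (m⁻² + 2∕γ_m)·Π_ν e^{−(κ_M∕(d+1))|z_ν|}` for EVERY unit torus. [cite: King1986, Thm 3.3 (3.6) p.655] -/
theorem abs_repKernel_le (L : ℕ) (hLodd : Odd L) (hL : 2 ≤ L) {a m2 : ℝ} (ha : 0 < a) (hm : 0 < m2) (M : Fin (d + 1) → ℕ) [∀ ν, NeZero (M ν)]
    (z : Fin (d + 1) → ℤ) :
    |repKernel M m2 z| ≤ (m2⁻¹ + 2 / gamM a m2 L) * ∏ ν, Real.exp (-(kapM (d + 1) a m2 L / (d + 1 : ℕ) * |(z ν : ℝ)|)) := by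
  have hκ : 0 < kapM (d + 1) a m2 L := (kapM_pos_le (d := d + 1) ha hm hL).1
  have hγ : 0 < gamM a m2 L := gamM_pos ha hm hL
  have hP0 : 0 < ∏ ν, Real.exp (-(kapM (d + 1) a m2 L / (d + 1 : ℕ) * |(z ν : ℝ)|)) := Finset.prod_pos fun ν _ => Real.exp_pos _
  unfold repKernel
  split_ifs with h
  · set b : Tor M := fun ν => ((z ν : ℤ) : ZMod (M ν)) with hb
    have hdist : ∀ ν, (|z ν| : ℝ) ≤ tdistT M 0 b := fun ν => by
      have := abs_torRep_le_tdistT M b ν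
      rwa [h] at this
    by_cases hb0 : (0 : Tor M) = b
    · -- the diagonal: `≤ m⁻²`
      have h1 := abs_kingS2Lim_le L M hLodd hL hm 0 b
      have hP1 : ∏ ν, Real.exp (-(kapM (d + 1) a m2 L / (d + 1 : ℕ) * |(z ν : ℝ)|)) = 1 := by
        have hz0 : z = 0 := by
          rw [← h, ← hb0]; funext ν; simp [torRep]
        simp [hz0]
      rw [hP1, mul_one]
      linarith [h1, show (0 : ℝ) ≤ 2 / gamM a m2 L by positivity]
    · have h1 := abs_kingS2Lim_le_decay L M hLodd hL ha hm hb0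
      have h2 := exp_neg_le_prod_of_forall_le (d := d) hκ.le hdist
      calc |kingS2Lim M m2 0 b| ≤ 2 / gamM a m2 L * Real.exp (-(kapM (d + 1) a m2 L * tdistT M 0 b)) := h1
        _ ≤ 2 / gamM a m2 L * ∏ ν, Real.exp (-(kapM (d + 1) a m2 L / (d + 1 : ℕ) * |(z ν : ℝ)|)) :=
            mul_le_mul_of_nonneg_left h2 (by positivity)
        _ ≤ (m2⁻¹ + 2 / gamM a m2 L) * ∏ ν, Real.exp (-(kapM (d + 1) a m2 L / (d + 1 : ℕ) * |(z ν : ℝ)|)) := by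
            gcongr; linarith [inv_pos.mpr hm]
  · rw [abs_zero]; positivity

/-- Termwise convergence: `repKernel_{Ω_k}(z) → S₂^{ℝ}(z)` along tori with all periods `→ ∞`. [cite: King1986, Thm 2.1 (2.22) p.654] -/
theorem tendsto_repKernel {m2 : ℝ} (hm : 0 < m2) (Mseq : ℕ → Fin (d + 1) → ℕ) (hpos : ∀ k ν, 0 < Mseq k ν)
    (hlim : ∀ ν, Tendsto (fun k => (Mseq k ν : ℝ)) atTop atTop) (z : Fin (d + 1) → ℤ) :
    Tendsto (fun k => haveI : ∀ ν, NeZero (Mseq k ν) := fun ν => ⟨(hpos k ν).ne'⟩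
      repKernel (Mseq k) m2 z) atTop (𝓝 (kingS2Inf m2 z)) := by
  have h1 := tendsto_kingS2Lim_volume hm Mseq hpos hlim z
  refine h1.congr' ?_
  have hev : ∀ μ, ∀ᶠ k in atTop, (2 * |z μ| : ℝ) < Mseq k μ := fun μ => (hlim μ).eventually_gt_atTop _
  filter_upwards [Filter.eventually_all.mpr hev] with k hk
  haveI : ∀ μ, NeZero (Mseq k μ) := fun μ => ⟨(hpos k μ).ne'⟩
  have hk' : ∀ μ, 2 * |z μ| < (Mseq k μ : ℤ) := fun μ => by exact_mod_cast hk μ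
  have hrep := torRep_intCast_of_two_abs_lt (Mseq k) (fun μ => by exact_mod_cast hk' μ)
  unfold repKernel
  rw [if_pos hrep]

/-- ★ `S₂^{ℝ}` is absolutely summable on `ℤ^{d+1}` (`|S₂^{ℝ}(z)| ≤ (m⁻² + 2∕γ_m)Π_ν e^{−(κ_M∕(d+1))|z_ν|}`). [cite: King1986, Thm 3.3 (3.6) p.655] -/
theorem summable_kingS2Inf {m2 : ℝ} (hm : 0 < m2) : Summable fun z : Fin (d + 1) → ℤ => kingS2Inf m2 z := by
  have hL : 2 ≤ 3 := by norm_num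
  have hLodd : Odd 3 := by decide
  have hκ : 0 < kapM (d + 1) 1 m2 3 := (kapM_pos_le (d := d + 1) one_pos hm hL).1
  have hκ' : 0 < kapM (d + 1) 1 m2 3 / (d + 1 : ℕ) := by positivity
  refine Summable.of_norm_bounded ((summable_prod_exp_neg_abs hκ').mul_left (m2⁻¹ + 2 / gamM 1 m2 3)) fun z => ?_
  rw [Real.norm_eq_abs]
  have hlim := tendsto_repKernel hm (fun k _ => k + 1) (fun k _ => Nat.succ_pos k)
    (fun ν => by
      have : Tendsto (fun k : ℕ => ((k : ℝ) + 1)) atTop atTop := tendsto_atTop_add_const_right _ 1 tendsto_natCast_atTop_atTop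
      exact this.congr fun k => by push_cast; ring) z
  refine le_of_tendsto ((continuous_abs.tendsto _).comp hlim) (Filter.Eventually.of_forall fun k => ?_)
  haveI : ∀ ν : Fin (d + 1), NeZero ((fun (k : ℕ) (_ : Fin (d + 1)) => k + 1) k ν) := fun ν => ⟨Nat.succ_ne_zero k⟩
  exact abs_repKernel_le 3 hLodd hL one_pos hm _ z

/-- ★★★ **THE SUSCEPTIBILITY SUM RULE IN INFINITE VOLUME**: `Σ_{z∈ℤ^{d+1}} S₂^{ℝ}(z) = m⁻²` (`m² > 0`) — the static susceptibility of the block-smeared free field on `ℝ^{d+1}`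
is exactly `m⁻²` (Tannery from the torus sum rule of part Ϝ-h under the uniform exponential majorant). [cite: King1986, (4.5) p.670, Thm 2.1 (2.22)–(2.23) p.654] -/
theorem tsum_kingS2Inf_eq_inv_mass {m2 : ℝ} (hm : 0 < m2) : ∑' z : Fin (d + 1) → ℤ, kingS2Inf m2 z = m2⁻¹ := by
  have hL : 2 ≤ 3 := by norm_num
  have hLodd : Odd 3 := by decide
  have hκ : 0 < kapM (d + 1) 1 m2 3 := (kapM_pos_le (d := d + 1) one_pos hm hL).1
  have hκ' : 0 < kapM (d + 1) 1 m2 3 / (d + 1 : ℕ) := by positivity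
  set Mseq : ℕ → Fin (d + 1) → ℕ := fun k _ => k + 1 with hMseq
  have hpos : ∀ k ν, 0 < Mseq k ν := fun k _ => Nat.succ_pos k
  have hlimM : ∀ ν, Tendsto (fun k => (Mseq k ν : ℝ)) atTop atTop := fun ν => by
    have : Tendsto (fun k : ℕ => ((k : ℝ) + 1)) atTop atTop := tendsto_atTop_add_const_right _ 1 tendsto_natCast_atTop_atTop
    exact this.congr fun k => by simp [hMseq]
  have htann := tendsto_tsum_of_dominated_convergence (𝓕 := atTop)
    (f := fun k z => haveI : ∀ ν, NeZero (Mseq k ν) := fun ν => ⟨(hpos k ν).ne'⟩; repKernel (Mseq k) m2 z)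
    (g := fun z => kingS2Inf m2 z) ((summable_prod_exp_neg_abs hκ').mul_left (m2⁻¹ + 2 / gamM 1 m2 3))
    (fun z => tendsto_repKernel hm Mseq hpos hlimM z)
    (Filter.Eventually.of_forall fun k z => by
      haveI : ∀ ν, NeZero (Mseq k ν) := fun ν => ⟨(hpos k ν).ne'⟩
      rw [Real.norm_eq_abs]
      exact abs_repKernel_le 3 hLodd hL one_pos hm (Mseq k) z)
  have hconst : (fun k => ∑' z : Fin (d + 1) → ℤ, haveI : ∀ ν, NeZero (Mseq k ν) := fun ν => ⟨(hpos k ν).ne'⟩; repKernel (Mseq k) m2 z)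
      = fun _ => m2⁻¹ := by
    funext k
    haveI : ∀ ν, NeZero (Mseq k ν) := fun ν => ⟨(hpos k ν).ne'⟩
    exact tsum_repKernel_eq (Mseq k) m2
  rw [hconst] at htann
  exact (tendsto_nhds_unique tendsto_const_nhds htann).symm

end SumRule

end Summit.QuantumFields.YangMills.BalabanUVNodes.N15KingModelRung

end
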